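import Summits.HubbardSuperconductivity.HubbardSuperconductivity.Theorems.BalabanIRBirComplexStableXYRCoreEnvelope
import HarnessLib

/-!
# Brascamp–Lieb on the log-concave core of the modulus weight: the hard-core limit

Support file for crux `BirComplexStableXYR` (stmt-HubbardSuperconductivity-14845) of route
`BalabanIR`, idea card `log-concave-core-bounded-phase`, step (c) / L1 ("Brascamp–Lieb variance
`Var(φ_x − φ_y | …) ≤ R_eff(x,y)/((c₀/4)K)` for all `L ≤ M`"), in the defect-free case.

`CoreBL.coreEnvelope_variance` (file `…RCoreEnvelope`) bounds the variance of a slice difference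
under the log-concave ENVELOPE `e^{-f_k}`, `f_k = K·[Σ_s Re F + k·Σ_s p(ΣΣ(…)² − a)]`, by
`256/(K c₀)` for every penalty strength `k ≥ k₀(B, c₀, a)`.  Letting `k → ∞` along `k₀ + n`
(dominated convergence, the `n = 0` envelope dominating) the envelope weight converges to the
modulus weight `e^{-K Re A}` RESTRICTED TO THE CONVEX CORE `{∀ s, ΣΣ((ext v)_{sh s w} − (ext v)_{sh s w'})² ≤ a}`,
and the variance bound survives (`core_variance`).  Feeding in the convexity radius of the class
(`convexityRadius`, `2a = δ₀²`) gives the headline `birComplexStableXYR_coreVariance`: for every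
`r ≥ 2`, `B`, `c₀ > 0` there is a core threshold `a > 0` such that for every admissible table,
every `K > 0` and all `2 ≤ L ≤ M`, the pinned modulus measure conditioned on the core has
`Var((ext v)(x,0) − (ext v)(y,0)) ≤ 256/(K c₀)` for all slice sites `x, y` — spin-wave-quality
fluctuations, non-perturbatively and uniformly in the volume and the anisotropy, for the complex
class's modulus weight (no ferromagnetism, no reflection positivity, no expansion).

No new definitions; fully proved, standard axioms.
-/

noncomputable section

namespace Summit.HubbardSuperconductivity.HubbardSuperconductivity.Theorems

namespace CoreBL

open scoped BigOperators Topology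
open MeasureTheory Filter Set Summit.HubbardSuperconductivity.BirComplexStableXYNegative
open Literature.Probability.LatticeModels CorePenalty

variable {r : ℕ} {L M : ℕ} [NeZero L] [NeZero M]

/-- **Brascamp–Lieb on the hard log-concave core.**  For a (U1)+(N)+(A ≤ B)+(C) table with a
convexity radius `δ₀`, core threshold `2a = δ₀²`, stiffness `K > 0` and a torus with `2 ≤ L ≤ M`:
the pinned modulus weight `w = exp(−K Σ_s Re F((ext v)∘sh s))` restricted to the convex core
`C = {∀ s, ΣΣ((ext v)_{sh s w} − (ext v)_{sh s w'})² ≤ a}` satisfies, for `h = (ext v)(x,0) − (ext v)(y,0)`,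
`(∫_C h² w)(∫_C w) − (∫_C h w)² ≤ (256/(K c₀))·(∫_C w)²` (all three set integrals converge).
Proof: `coreEnvelope_variance` at `k = k₀ + n` and dominated convergence `n → ∞`.
[cite: BrascampLieb1976, Thm 4.1] -/
theorem core_variance (hr : 2 ≤ r) (c : Table r) (hU1 : ∀ n ∈ c.support, ∑ w, n w = 0)
    (hN : c.sum (fun _ a => a) = 0) {B c₀ : ℝ} (hc₀ : 0 < c₀) (hA : normA c ≤ B)
    (hC : ∀ φ : W r → ℝ, c₀ * ∑ w, ∑ w', (1 - Real.cos (φ w - φ w')) ≤ (genF c φ).re)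
    {δ₀ : ℝ} (hδ₀ : 0 < δ₀)
    (hconv : ∀ φ : W r → ℝ, (∀ w w', |φ w - φ w'| ≤ δ₀) → ∀ ψ : W r → ℝ,
      c₀ / 4 * ∑ w, ∑ w', (ψ w - ψ w') ^ 2 ≤
        (-c.sum (fun n b => b * (((∑ w, (n w : ℝ) * ψ w) ^ 2 : ℝ) : ℂ) *
          Complex.exp (Complex.I * ((∑ w, (n w : ℝ) * φ w : ℝ) : ℂ)))).re)
    {a K : ℝ} (ha : 2 * a = δ₀ ^ 2) (hK : 0 < K) (hL : 2 ≤ L) (hLM : L ≤ M)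
    (x y : TorusSite 2 L) :
    let ext : ({i : Λ L M // i ≠ 0} → ℝ) → Λ L M → ℝ :=
      fun v i => if h : i = (0 : Λ L M) then (0 : ℝ) else v ⟨i, h⟩
    let w : ({i : Λ L M // i ≠ 0} → ℝ) → ℝ := fun v =>
      Real.exp (-(K * ∑ s : Λ L M, (genF c (fun w => ext v (sh L M s w))).re))
    let C : Set ({i : Λ L M // i ≠ 0} → ℝ) := {v | ∀ s : Λ L M,
      ∑ w : W r, ∑ w' : W r, (ext v (sh L M s w) - ext v (sh L M s w')) ^ 2 ≤ a}
    let hobs : ({i : Λ L M // i ≠ 0} → ℝ) → ℝ := fun v => ext v (x, 0) - ext v (y, 0)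
    IntegrableOn w C ∧ IntegrableOn (fun v => hobs v * w v) C ∧
    IntegrableOn (fun v => hobs v ^ 2 * w v) C ∧
    (∫ v in C, hobs v ^ 2 * w v) * (∫ v in C, w v) - (∫ v in C, hobs v * w v) ^ 2 ≤
      256 / (K * c₀) * (∫ v in C, w v) ^ 2 := by
  intro ext w C hobs
  have ha0 : 0 < a := by nlinarith [sq_nonneg δ₀, hδ₀]
  -- the penalty strengths `k₀ + n`
  set k₀ : ℝ := (2 * max B 0 + c₀ / 4) / (6 * a ^ 2) with hk₀
  have h6a : 0 < 6 * a ^ 2 := by positivity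
  have hk₀nn : 0 ≤ k₀ := div_nonneg (by positivity) h6a.le
  have hkn0 : ∀ n : ℕ, 0 ≤ k₀ + n := fun n => by positivity
  have hkn : ∀ n : ℕ, 2 * max B 0 + c₀ / 4 ≤ (k₀ + n) * (6 * a ^ 2) := fun n => by
    have h1 : k₀ * (6 * a ^ 2) = 2 * max B 0 + c₀ / 4 := div_mul_cancel₀ _ h6a.ne'
    have h2 : (0 : ℝ) ≤ n * (6 * a ^ 2) := by positivity
    nlinarith
  -- the two pieces of the envelope
  set R : ({i : Λ L M // i ≠ 0} → ℝ) → ℝ := fun v =>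
    ∑ s : Λ L M, (genF c (fun w => ext v (sh L M s w))).re with hR
  set P : ({i : Λ L M // i ≠ 0} → ℝ) → ℝ := fun v =>
    ∑ s : Λ L M, (max ((∑ w : W r, ∑ w' : W r,
      (ext v (sh L M s w) - ext v (sh L M s w')) ^ 2) - a) 0) ^ 3 with hP
  set E : ℕ → ({i : Λ L M // i ≠ 0} → ℝ) → ℝ := fun n v =>
    Real.exp (-(K * (R v + (k₀ + n) * P v))) with hE
  -- the envelope facts, level by level
  have henv : ∀ n : ℕ, Integrable (E n) ∧ Integrable (fun v => hobs v * E n v) ∧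
      Integrable (fun v => hobs v ^ 2 * E n v) ∧
      (∫ v, hobs v ^ 2 * E n v) * (∫ v, E n v) - (∫ v, hobs v * E n v) ^ 2 ≤
        256 / (K * c₀) * (∫ v, E n v) ^ 2 := fun n =>
    coreEnvelope_variance hr c hU1 hN hc₀ hA hC hδ₀ hconv ha (hkn0 n) (hkn n) hK hL hLM x y
  -- basic properties
  have hPnn : ∀ v, 0 ≤ P v := fun v => Finset.sum_nonneg fun s _ => pen_nonneg _
  have hEle : ∀ n v, E n v ≤ E 0 v := fun n v => by
    simp only [hE, Nat.cast_zero, add_zero]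
    refine Real.exp_le_exp.2 (neg_le_neg (mul_le_mul_of_nonneg_left ?_ hK.le))
    have : k₀ * P v ≤ (k₀ + n) * P v :=
      mul_le_mul_of_nonneg_right (by linarith [(n.cast_nonneg : (0:ℝ) ≤ n)]) (hPnn v)
    linarith
  have hEpos : ∀ n v, 0 < E n v := fun n v => Real.exp_pos _
  have hEcont : ∀ n, Continuous (E n) := fun n => by
    have h := (contDiff_envelope (L := L) (M := M) c K (k₀ + n) a).continuous
    exact (h.neg).rexp
  have hobs_cont : Continuous hobs :=
    ((contDiff_ext_apply (L := L) (M := M) ((x, 0) : Λ L M) (n := 0)).continuous).sub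
      ((contDiff_ext_apply (L := L) (M := M) ((y, 0) : Λ L M) (n := 0)).continuous)
  -- the core: closed, hence measurable
  have hCmeas : MeasurableSet C := by
    have hCeq : C = ⋂ s : Λ L M, {v | ∑ w : W r, ∑ w' : W r,
        (ext v (sh L M s w) - ext v (sh L M s w')) ^ 2 ≤ a} := by
      ext v; simp [C, Set.mem_iInter]
    rw [hCeq]
    refine (isClosed_iInter fun s => isClosed_le ?_ continuous_const).measurableSet
    exact continuous_finsetSum _ fun w _ => continuous_finsetSum _ fun w' _ =>
      (((contDiff_ext_apply (L := L) (M := M) (sh L M s w) (n := 0)).continuous).sub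
        ((contDiff_ext_apply (L := L) (M := M) (sh L M s w') (n := 0)).continuous)).pow 2
  -- on the core the envelope is the modulus weight, off the core it dies
  have hPC : ∀ v, v ∈ C → P v = 0 := fun v hv => by
    refine Finset.sum_eq_zero fun s _ => pen_eq_zero ?_
    have := hv s
    linarith
  have hPC' : ∀ v, v ∉ C → 0 < P v := fun v hv => by
    simp only [C, Set.mem_setOf_eq, not_forall, not_le] at hv
    obtain ⟨s, hs⟩ := hv
    refine lt_of_lt_of_le (pen_pos (sub_pos.2 hs)) ?_
    exact Finset.single_le_sum (f := fun s => (max ((∑ w : W r, ∑ w' : W r,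
      (ext v (sh L M s w) - ext v (sh L M s w')) ^ 2) - a) 0) ^ 3)
      (fun s _ => pen_nonneg _) (Finset.mem_univ s)
  have hlim : ∀ v, Tendsto (fun n => E n v) atTop (𝓝 (C.indicator w v)) := by
    intro v
    by_cases hv : v ∈ C
    · rw [Set.indicator_of_mem hv]
      have : ∀ n, E n v = w v := fun n => by
        simp only [hE, hPC v hv, mul_zero, add_zero]
        rfl
      simp_rw [this]
      exact tendsto_const_nhds
    · rw [Set.indicator_of_notMem hv]
      have hKP : 0 < K * P v := mul_pos hK (hPC' v hv)
      have hfac : ∀ n : ℕ, E n v = Real.exp (-(K * (R v + k₀ * P v))) * Real.exp (-(K * P v)) ^ n := by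
        intro n
        rw [← Real.exp_nat_mul, ← Real.exp_add]
        simp only [hE]
        congr 1; ring
      simp_rw [hfac]
      rw [show (0 : ℝ) = Real.exp (-(K * (R v + k₀ * P v))) * 0 by simp]
      refine Tendsto.const_mul _ (tendsto_pow_atTop_nhds_zero_of_lt_one (Real.exp_pos _).le ?_)
      rw [Real.exp_lt_one_iff]
      linarith
  -- dominated convergence for the three moments
  obtain ⟨hZ0, hA0, hB0, -⟩ := henv 0
  have T0 : Tendsto (fun n => ∫ v, E n v) atTop (𝓝 (∫ v, C.indicator w v)) := by
    refine tendsto_integral_of_dominated_convergence (fun v => E 0 v)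
      (fun n => (hEcont n).aestronglyMeasurable) hZ0 (fun n => ae_of_all _ fun v => ?_)
      (ae_of_all _ hlim)
    rw [Real.norm_eq_abs, abs_of_pos (hEpos n v)]
    exact hEle n v
  have T1 : Tendsto (fun n => ∫ v, hobs v * E n v) atTop
      (𝓝 (∫ v, hobs v * C.indicator w v)) := by
    refine tendsto_integral_of_dominated_convergence (fun v => ‖hobs v * E 0 v‖)
      (fun n => (hobs_cont.mul (hEcont n)).aestronglyMeasurable) hA0.norm
      (fun n => ae_of_all _ fun v => ?_) (ae_of_all _ fun v => (hlim v).const_mul _)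
    rw [norm_mul, norm_mul, Real.norm_eq_abs (E n v), Real.norm_eq_abs (E 0 v),
      abs_of_pos (hEpos n v), abs_of_pos (hEpos 0 v)]
    exact mul_le_mul_of_nonneg_left (hEle n v) (norm_nonneg _)
  have T2 : Tendsto (fun n => ∫ v, hobs v ^ 2 * E n v) atTop
      (𝓝 (∫ v, hobs v ^ 2 * C.indicator w v)) := by
    refine tendsto_integral_of_dominated_convergence (fun v => hobs v ^ 2 * E 0 v)
      (fun n => ((hobs_cont.pow 2).mul (hEcont n)).aestronglyMeasurable) hB0
      (fun n => ae_of_all _ fun v => ?_) (ae_of_all _ fun v => (hlim v).const_mul _)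
    rw [norm_mul, Real.norm_eq_abs (E n v), abs_of_pos (hEpos n v), Real.norm_eq_abs,
      abs_of_nonneg (sq_nonneg _)]
    exact mul_le_mul_of_nonneg_left (hEle n v) (sq_nonneg _)
  -- pass to the limit in the variance inequality
  have hVlim : (∫ v, hobs v ^ 2 * C.indicator w v) * (∫ v, C.indicator w v) -
      (∫ v, hobs v * C.indicator w v) ^ 2 ≤
        256 / (K * c₀) * (∫ v, C.indicator w v) ^ 2 :=
    le_of_tendsto_of_tendsto' ((T2.mul T0).sub (T1.pow 2)) (T0.pow 2 |>.const_mul _)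
      fun n => (henv n).2.2.2
  -- rewrite as set integrals
  have e0 : (∫ v, C.indicator w v) = ∫ v in C, w v := integral_indicator hCmeas
  have e1 : (∫ v, hobs v * C.indicator w v) = ∫ v in C, hobs v * w v := by
    rw [← integral_indicator hCmeas]
    refine integral_congr_ae (ae_of_all _ fun v => ?_)
    exact (Set.indicator_mul_right C hobs w).symm
  have e2 : (∫ v, hobs v ^ 2 * C.indicator w v) = ∫ v in C, hobs v ^ 2 * w v := by
    rw [← integral_indicator hCmeas]
    refine integral_congr_ae (ae_of_all _ fun v => ?_)
    exact (Set.indicator_mul_right C (fun v => hobs v ^ 2) w).symm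
  -- integrability on the core (domination by the `n = 0` envelope, which equals `w` on the core)
  have hwE : ∀ v, C.indicator w v ≤ E 0 v ∧ 0 ≤ C.indicator w v := fun v => by
    by_cases hv : v ∈ C
    · rw [Set.indicator_of_mem hv]
      refine ⟨le_of_eq ?_, (Real.exp_pos _).le⟩
      simp only [hE, hPC v hv, mul_zero, add_zero, Nat.cast_zero]
      rfl
    · rw [Set.indicator_of_notMem hv]; exact ⟨(hEpos 0 v).le, le_rfl⟩
  have hw_cont : Continuous w := by
    have h := (contDiff_envelope (L := L) (M := M) c K 0 a).continuous
    have : w = fun v => Real.exp (-(K * (R v + 0 * P v))) := by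
      funext v; simp [w, hR]
    rw [this]
    exact h.neg.rexp
  have hI0 : IntegrableOn w C := by
    rw [← integrable_indicator_iff hCmeas]
    refine hZ0.mono' (hw_cont.aestronglyMeasurable.indicator hCmeas) (ae_of_all _ fun v => ?_)
    rw [Real.norm_eq_abs, abs_of_nonneg (hwE v).2]
    exact (hwE v).1
  have hI1 : IntegrableOn (fun v => hobs v * w v) C := by
    rw [← integrable_indicator_iff hCmeas]
    refine hA0.norm.mono' ((hobs_cont.mul hw_cont).aestronglyMeasurable.indicator hCmeas)
      (ae_of_all _ fun v => ?_)
    rw [Set.indicator_mul_right C hobs w, norm_mul, norm_mul, Real.norm_eq_abs (C.indicator w v),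
      abs_of_nonneg (hwE v).2, Real.norm_eq_abs (E 0 v), abs_of_pos (hEpos 0 v)]
    exact mul_le_mul_of_nonneg_left (hwE v).1 (norm_nonneg _)
  have hI2 : IntegrableOn (fun v => hobs v ^ 2 * w v) C := by
    rw [← integrable_indicator_iff hCmeas]
    refine hB0.mono' (((hobs_cont.pow 2).mul hw_cont).aestronglyMeasurable.indicator hCmeas)
      (ae_of_all _ fun v => ?_)
    rw [Set.indicator_mul_right C (fun v => hobs v ^ 2) w, norm_mul, Real.norm_eq_abs,
      abs_of_nonneg (sq_nonneg _), Real.norm_eq_abs, abs_of_nonneg (hwE v).2]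
    exact mul_le_mul_of_nonneg_left (hwE v).1 (sq_nonneg _)
  refine ⟨hI0, hI1, hI2, ?_⟩
  rw [← e0, ← e1, ← e2]
  exact hVlim

/-- **THE CORE VARIANCE BOUND (Brascamp–Lieb on the log-concave core, uniformly in the volume).**
For every `r ≥ 2`, `B` and `c₀ > 0` there is a core threshold `a = a(r, B, c₀) > 0` such that for
every table with (U1), (N), (A) `normA ≤ B`, (C) `c₀`, every stiffness `K > 0`, every torus
`(ℤ/L)² × ℤ/M` with `2 ≤ L ≤ M` and all slice sites `x, y`: the pinned modulus weight
`w = |e^{−A(ext v)}| = exp(−K Σ_s Re F((ext v)∘sh s))` conditioned on the convex core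
`C = {∀ s, ΣΣ((ext v)_{sh s w} − (ext v)_{sh s w'})² ≤ a}` (where it is log-concave with Hessian
floor `K(c₀/4)·Σ_s ΣΣ(…)²`) has
`Var_{w|C}((ext v)(x,0) − (ext v)(y,0)) ≤ 256/(K c₀)`, i.e.
`(∫_C h² w)(∫_C w) − (∫_C h w)² ≤ (256/(Kc₀))(∫_C w)²` — spin-wave-size fluctuations of slice
differences, NON-perturbatively and uniformly in `L ≤ M`, for the modulus of the complex class
(no ferromagnetism, no reflection positivity, no expansion): the defect-free case of step L1(c) of
card `log-concave-core-bounded-phase`. [cite: BrascampLieb1976, Thm 4.1] -/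
theorem birComplexStableXYR_coreVariance (r : ℕ) (B c₀ : ℝ) (hr : 2 ≤ r) (hc₀ : 0 < c₀) :
    ∃ a : ℝ, 0 < a ∧ ∀ c : Table r,
      (∀ n ∈ c.support, ∑ w, n w = 0) → c.sum (fun _ a => a) = 0 → normA c ≤ B →
      (∀ φ : W r → ℝ, c₀ * ∑ w, ∑ w', (1 - Real.cos (φ w - φ w')) ≤ (genF c φ).re) →
      ∀ (K : ℝ), 0 < K → ∀ (L M : ℕ) [NeZero L] [NeZero M], 2 ≤ L → L ≤ M →
      ∀ x y : TorusSite 2 L,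
      let ext : ({i : Λ L M // i ≠ 0} → ℝ) → Λ L M → ℝ :=
        fun v i => if h : i = (0 : Λ L M) then (0 : ℝ) else v ⟨i, h⟩
      let w : ({i : Λ L M // i ≠ 0} → ℝ) → ℝ := fun v =>
        Real.exp (-(K * ∑ s : Λ L M, (genF c (fun w => ext v (sh L M s w))).re))
      let C : Set ({i : Λ L M // i ≠ 0} → ℝ) := {v | ∀ s : Λ L M,
        ∑ w : W r, ∑ w' : W r, (ext v (sh L M s w) - ext v (sh L M s w')) ^ 2 ≤ a}
      let hobs : ({i : Λ L M // i ≠ 0} → ℝ) → ℝ := fun v => ext v (x, 0) - ext v (y, 0)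
      IntegrableOn w C ∧ IntegrableOn (fun v => hobs v * w v) C ∧
      IntegrableOn (fun v => hobs v ^ 2 * w v) C ∧
      (∫ v in C, hobs v ^ 2 * w v) * (∫ v in C, w v) - (∫ v in C, hobs v * w v) ^ 2 ≤
        256 / (K * c₀) * (∫ v in C, w v) ^ 2 := by
  obtain ⟨δ₀, hδ₀, hrad⟩ := convexityRadius r B c₀ hc₀
  refine ⟨δ₀ ^ 2 / 2, by positivity, ?_⟩
  intro c hU1 hN hA hC K hK L M _ _ hL hLM x y
  have hconv : ∀ φ : W r → ℝ, (∀ w w', |φ w - φ w'| ≤ δ₀) → ∀ ψ : W r → ℝ,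
      c₀ / 4 * ∑ w, ∑ w', (ψ w - ψ w') ^ 2 ≤
        (-c.sum (fun n b => b * (((∑ w, (n w : ℝ) * ψ w) ^ 2 : ℝ) : ℂ) *
          Complex.exp (Complex.I * ((∑ w, (n w : ℝ) * φ w : ℝ) : ℂ)))).re :=
    fun φ hφ ψ => (hrad c hU1 hN hA hC φ hφ ψ).1
  exact core_variance hr c hU1 hN hc₀ hA hC hδ₀ hconv (a := δ₀ ^ 2 / 2) (by ring) hK hL hLM x y

/-- **Registered stub form of the core variance bound** (`stub_coreVarianceBL` on
stmt-HubbardSuperconductivity-14845): `birComplexStableXYR_coreVariance` with the pinned extension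
`ext` passed as an explicitly characterised argument and `w`, `C`, `h` inlined (no `let`s), so that
the statement is a single registrable Prop term. [cite: BrascampLieb1976, Thm 4.1] -/
theorem stub_coreVarianceBL : ∀ (r : ℕ) (B c₀ : ℝ), 2 ≤ r → 0 < c₀ → ∃ a₀ : ℝ, 0 < a₀ ∧ ∀ c : Table r, (∀ n ∈ c.support, ∑ w, n w = 0) → c.sum (fun _ a => a) = 0 → normA c ≤ B → (∀ φ : W r → ℝ, c₀ * ∑ w, ∑ w', (1 - Real.cos (φ w - φ w')) ≤ (genF c φ).re) → ∀ K : ℝ, 0 < K → ∀ (L M : ℕ) [NeZero L] [NeZero M], 2 ≤ L → L ≤ M → ∀ x y : TorusSite 2 L, ∀ ext : ({i : Λ L M // i ≠ 0} → ℝ) → Λ L M → ℝ, (∀ v i, ext v i = if h : i = (0 : Λ L M) then (0 : ℝ) else v ⟨i, h⟩) → IntegrableOn (fun v => Real.exp (-(K * ∑ s : Λ L M, (genF c (fun w => ext v (sh L M s w))).re))) {v | ∀ s : Λ L M, ∑ w : W r, ∑ w' : W r, (ext v (sh L M s w) - ext v (sh L M s w')) ^ 2 ≤ a₀} ∧ IntegrableOn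 (fun v => (ext v (x, 0) - ext v (y, 0)) * Real.exp (-(K * ∑ s : Λ L M, (genF c (fun w => ext v (sh L M s w))).re))) {v | ∀ s : Λ L M, ∑ w : W r, ∑ w' : W r, (ext v (sh L M s w) - ext v (sh L M s w')) ^ 2 ≤ a₀} ∧ IntegrableOn (fun v => (ext v (x, 0) - ext v (y, 0)) ^ 2 * Real.exp (-(K * ∑ s : Λ L M, (genF c (fun w => ext v (sh L M s w))).re))) {v | ∀ s : Λ L M, ∑ w : W r, ∑ w' : W r, (ext v (sh L M s w) - ext v (sh L M s w')) ^ 2 ≤ a₀} ∧ (∫ v in {v | ∀ s : Λ L M, ∑ w : W r, ∑ w' : W r, (ext v (sh L M s w) - ext v (sh L M s w')) ^ 2 ≤ a₀}, (ext v (x, 0) - ext v (y, 0)) ^ 2 * Real.exp (-(K * ∑ s : Λ L M, (genF c (fun w => ext v (sh L M s w))).re))) * (∫ v in {v | ∀ s : Λ L M, ∑ w : W r, ∑ w' : W r, (ext v (sh L M s w) - ext v (sh L M s w')) ^ 2 ≤ a₀}, Real.exp (-(K * ∑ s : Λ L M, (genF c (fun w => ext v (sh L M s w))).re))) - (∫ v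 in {v | ∀ s : Λ L M, ∑ w : W r, ∑ w' : W r, (ext v (sh L M s w) - ext v (sh L M s w')) ^ 2 ≤ a₀}, (ext v (x, 0) - ext v (y, 0)) * Real.exp (-(K * ∑ s : Λ L M, (genF c (fun w => ext v (sh L M s w))).re))) ^ 2 ≤ 256 / (K * c₀) * (∫ v in {v | ∀ s : Λ L M, ∑ w : W r, ∑ w' : W r, (ext v (sh L M s w) - ext v (sh L M s w')) ^ 2 ≤ a₀}, Real.exp (-(K * ∑ s : Λ L M, (genF c (fun w => ext v (sh L M s w))).re))) ^ 2 := by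
  intro r B c₀ hr hc₀
  obtain ⟨a₀, ha₀, h⟩ := birComplexStableXYR_coreVariance r B c₀ hr hc₀
  refine ⟨a₀, ha₀, ?_⟩
  intro c hU1 hN hA hC K hK L M _ _ hL hLM x y ext hext
  have e : ext = fun v i => if h : i = (0 : Λ L M) then (0 : ℝ) else v ⟨i, h⟩ :=
    funext fun v => funext fun i => hext v i
  subst e
  exact h c hU1 hN hA hC K hK L M hL hLM x y

end CoreBL

end Summit.HubbardSuperconductivity.HubbardSuperconductivity.Theorems
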